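import Summits.QuantumFields.BalabanUV.Beta.EriceRemainderEnclosureHistoryAutonomyComparisonAgeCompositionAdaptiveCascade

/-!
# EriceRemainderEnclosureHistoryAutonomyComparisonAgeCompositionAdaptiveCascadeRate — (E108b) route (N), first order: THE ADAPTIVE RESIDUAL CASCADE WITH A
# FREE RATE CONSTANT (pure).  (E101a) `renewal_nonneg_adaptive_cascade` hard-wires the variation rate `lo_j·ν_j ≤ 4x_j` and hence the closure
# `hi_{j−1}·(4x_j(1+κ_j) + κ_j) ≤ κ_{j−1}·(1 − x_j(1+κ_j))·lo_j`; the `4` is (E95b)'s.  This file restates the cascade with `lo_j·ν_j ≤ A·x_j` and the closure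
# `hi_{j−1}·(A·x_j(1+κ_j) + κ_j) ≤ κ_{j−1}·(1 − x_j(1+κ_j))·lo_j` for an ARBITRARY real `A` (**`renewal_nonneg_adaptive_cascade_rate`**) — the proof is
# (E101a)'s verbatim (its one-level lemma `adaptive_cascade_level` is rate-free and used BY NAME); with (E108a)'s constant `A = 3` the sequel (E108c)
# instantiates it along flows.

Cell `pub-balaban`, β-function sub-cell, BINDER row D4 «RemainderConst leaves for Bałaban's split» (`HOME/BINDER-OWNERS.md`; owner lineage `b2b-balaban-beta-an4`;
this file by co-owner #2 lineage `b2b-balaban-beta-d4-p2`, generation 90), β-FLOW TEAM duty (1), FREEZE (0) honoured (def-free; nothing restated; Mathlib + (E101a)).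

HONEST FRAMING (page 1, verbatim and binding).  *"Discharging BetaPertH makes Bałaban's UV stability UNCONDITIONAL — a real constructive-QFT result; it is
NOT the continuum limit and NOT the Clay problem."*  THIS FILE DISCHARGES NOTHING OF THE KIND.  Finite non-negative linear algebra about abstract reads,
masses, rates and residuals; no flow, no functional, nothing printed — the form, signs, ages and moments of Bałaban's (1.22) limit functional are NOT
PRINTED ([I] p. 298; GAPS G-t4-U2-1∕-2) and NOT asserted.  Row D4 class UNCHANGED (critical-path width 0; instance 0∕1; D4 DISCHARGE NO DATE).  HONEST
DEPENDENCY: continuum YM on T⁴ ⇐ BetaPertH ∧ nine spine estimates (0/9 proved); BetaPertH ⇐ (D1) ∧ (D4) ∧ CAP+tail; G-an2-4 gates asym, D1 and NE2/3/4.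

THE POINT (README `HOME/b2b-balaban-beta-d4-p2/g90/README.md` §6).  Uses (E101a) `adaptive_cascade_level` BY NAME.  NOT CLAIMED: anything printed — NOT B12 Thm 2,
NOT BetaPertH, NOT continuum, NOT Clay.

WHAT IS PROVED ([folklore]; 0 `def`, 0 sorry).  **`renewal_nonneg_adaptive_cascade_rate`**.
-/
noncomputable section
open Finset

namespace Summit.QuantumFields.BalabanUV.Beta.EriceRemainderEnclosureHistoryAutonomyComparisonAgeCompositionAdaptiveCascadeRate

open Summit.QuantumFields.BalabanUV.Beta.EriceRemainderEnclosureHistoryAutonomyComparisonAgeCompositionAdaptiveCascade (adaptive_cascade_level)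

/-- **THE ADAPTIVE RESIDUAL CASCADE WITH RATE CONSTANT `A` (pure).**  As (E101a) `renewal_nonneg_adaptive_cascade` with `lo_j·ν_j(q) ≤ A·x_j(q)` and the
closures `x_0(q)(1 + κ 0 q) ≤ 1`, `x_j(q)(1 + κ j q) < 1`, `hi (j−1)·(A·x_j(q)(1 + κ j q) + κ j q) ≤ κ (j−1) q·(1 − x_j(q)(1 + κ j q))·lo j` (`1 ≤ j < r`):
THEN `0 ≤ ε ≤ e` at every pin. [folklore] -/
theorem renewal_nonneg_adaptive_cascade_rate {A : ℝ} {r N Kw : ℕ} {κ : ℕ → ℕ → ℝ} {lo hi : ℕ → ℕ} {w : ℕ → ℕ → ℕ → ℝ} {x ν O : ℕ → ℕ → ℝ} {e ε : ℕ → ℝ}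
    (hκ0 : ∀ j q, 0 ≤ κ j q)
    (hclose0 : ∀ q, x 0 q * (1 + κ 0 q) ≤ 1)
    (hclose : ∀ j q, 1 ≤ j → j < r → x j q * (1 + κ j q) < 1 ∧
      (hi (j - 1) : ℝ) * (A * x j q * (1 + κ j q) + κ j q) ≤ κ (j - 1) q * (1 - x j q * (1 + κ j q)) * lo j)
    (hnest : ∀ j, j + 1 < r → hi j ≤ lo (j + 1)) (hlohi : ∀ j, 1 ≤ j → j < r → lo j ≤ hi j) (hlo1 : ∀ j, 1 ≤ j → j < r → 1 ≤ lo j)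
    (hw0 : ∀ j q l, 0 ≤ w j q l) (hwa : ∀ j q l, hi j ≤ l → w j q l = 0) (hν0 : ∀ j q, 0 ≤ ν j q)
    (hrow : ∀ j q, j < r → ∑ l ∈ range Kw, w j q l ≤ x j q)
    (hνx : ∀ j q, 1 ≤ j → j < r → (lo j : ℝ) * ν j q ≤ A * x j q)
    (hO : ∀ j q, O j q = ∑ l ∈ range Kw, w j q l * ε (q + 1 + l))
    (hvar : ∀ j m d (T : ℝ), 1 ≤ j → j < r → 1 ≤ d → d ≤ lo j → 0 ≤ T → (∀ q, m < q → 0 ≤ ε q) →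
      (∀ q, m < q → q ≤ m + hi j → ε q ≤ T) → O j m - O j (m + d) ≤ ν j m * d * T)
    (he0 : ∀ q, 0 ≤ e q) (hea : ∀ q, e (q + 1) ≤ e q)
    (hεt : ∀ q, N < q → ε q = 0) (hrec : ∀ q, ε q = e q - ∑ j ∈ range r, O j q) : ∀ m, 0 ≤ ε m ∧ ε m ≤ e m := by
  -- downward induction from the horizon: it suffices to do one pin given the bounds beyond it
  suffices step : ∀ m, (∀ q, m < q → 0 ≤ ε q ∧ ε q ≤ e q) → 0 ≤ ε m ∧ ε m ≤ e m by
    have main : ∀ n m, N < m + n → 0 ≤ ε m ∧ ε m ≤ e m := by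
      intro n
      induction n with
      | zero => intro m hm; rw [hεt m (by omega)]; exact ⟨le_rfl, he0 m⟩
      | succ n ih => intro m hm; exact step m fun q hq => ih q (by omega)
    exact fun m => main (N + 1) m (by omega)
  intro m IH
  have hOnn : ∀ i q, m ≤ q → 0 ≤ O i q := fun i q hq => by
    rw [hO]; exact sum_nonneg fun l _ => mul_nonneg (hw0 i q l) (IH _ (by omega)).1
  have hsum0 : 0 ≤ ∑ j ∈ range r, O j m := sum_nonneg fun j _ => hOnn j m le_rfl
  refine ⟨?_, by rw [hrec m]; linarith⟩
  -- the constants at this pin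
  obtain ⟨C, hC⟩ : ∃ C : ℕ → ℝ, ∀ j, C j = 1 + κ j m := ⟨_, fun _ => rfl⟩
  have hC1 : ∀ j, 1 ≤ C j := fun j => by rw [hC]; linarith [hκ0 j m]
  -- the windows of the younger levels fit under the youngest ages of the older ones
  have hhilo : ∀ j j', j < j' → j' < r → hi j ≤ lo j' := by
    intro j j' hjj' hj'r
    induction j', hjj' using Nat.le_induction with
    | base => exact hnest j hj'r
    | succ j' hle ih =>
      have h1 := ih (by omega)
      have h2 := hnest j' hj'r
      have h3 := hlohi j' (by omega) (by omega)
      omega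
  -- the residuals and the variation rates (opaque names with defining equations)
  obtain ⟨B, hB⟩ : ∃ B : ℕ → ℝ, ∀ j, B j = e m - ∑ i ∈ Ico j r, O i m := ⟨_, fun _ => rfl⟩
  obtain ⟨U, hU⟩ : ∃ U : ℕ → ℝ, ∀ j, U j = ∑ i ∈ Ico (j + 1) r, ν i m * (C i * B (i + 1)) := ⟨_, fun _ => rfl⟩
  have hBr : B r = e m := by rw [hB, Ico_self, sum_empty, sub_zero]
  have hB0 : B 0 = ε m := by rw [hB, hrec m, range_eq_Ico]
  -- the case of no level at all
  rcases Nat.eq_zero_or_pos r with hr0 | hrpos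
  · rw [hr0] at hBr; rw [← hB0, hBr]; exact he0 m
  -- one level, packaged
  have level : ∀ j, j < r → (∀ j', j < j' → j' ≤ r → 0 ≤ B j') →
      (∀ j', j < j' → j' < r → ∀ q, m < q → q ≤ m + hi j' → ε q ≤ C j' * B (j' + 1)) →
      (hi j : ℝ) * U j ≤ κ j m * B (j + 1) →
      (∀ q, m < q → q ≤ m + hi j → ε q ≤ C j * B (j + 1)) ∧ (1 - x j m * C j) * B (j + 1) ≤ B j := by
    intro j hjr hBnn hT hUj
    have hU' : (hi j : ℝ) * ∑ i ∈ Ico (j + 1) r, ν i m * (C i * B (i + 1)) ≤ (C j - 1) * B (j + 1) := by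
      rw [← hU j, hC j]; linarith
    exact adaptive_cascade_level hjr hC1 hw0 hwa hν0 hrow hO (fun j' hjj' hj'r => hhilo j j' hjj' hj'r)
      (fun j' d T hjj' hj'r => hvar j' m d T (by omega) hj'r) hea hrec IH hB hBnn hT hU'
  -- THE DESCENT from j = r to j = 1
  have main : ∀ n j, j + n = r → 1 ≤ j →
      (∀ j', j ≤ j' → j' ≤ r → 0 ≤ B j') ∧
      (∀ j', j ≤ j' → j' < r → ∀ q, m < q → q ≤ m + hi j' → ε q ≤ C j' * B (j' + 1)) ∧
      ((hi (j - 1) : ℝ) * U (j - 1) ≤ κ (j - 1) m * B j) := by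
    intro n
    induction n with
    | zero =>
      intro j hj hj1
      rw [add_zero] at hj
      subst hj
      refine ⟨fun j' h1 h2 => ?_, fun j' h1 h2 => absurd h2 (not_lt.mpr h1), ?_⟩
      · rw [show j' = j from le_antisymm h2 h1, hBr]; exact he0 m
      · rw [hU, show j - 1 + 1 = j from Nat.sub_add_cancel hj1, Ico_self, sum_empty, mul_zero, hBr]
        exact mul_nonneg (hκ0 _ m) (he0 m)
    | succ n ih =>
      intro j hj hj1
      obtain ⟨hBnn, hT, hUj⟩ := ih (j + 1) (by omega) (by omega)
      have hjr : j < r := by omega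
      rw [Nat.add_sub_cancel] at hUj
      obtain ⟨htar, hpeel⟩ := level j hjr (fun j' h1 h2 => hBnn j' (by omega) h2) (fun j' h1 h2 => hT j' (by omega) h2) hUj
      have hBj1 : 0 ≤ B (j + 1) := hBnn (j + 1) le_rfl (by omega)
      -- the closure at level j ≥ 1: x_j C_j < 1, so B j ≥ (1 − x_jC_j) B(j+1) ≥ 0
      obtain ⟨hxC, hcl⟩ := hclose j m hj1 hjr
      rw [← hC j] at hxC hcl
      have hlamj : 0 < 1 - x j m * C j := by linarith
      have hBj : (1 - x j m * C j) * B (j + 1) ≤ B j := hpeel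
      have hBj0 : 0 ≤ B j := le_trans (mul_nonneg hlamj.le hBj1) hBj
      refine ⟨fun j' h1 h2 => ?_, fun j' h1 h2 => ?_, ?_⟩
      · by_cases hj' : j' = j
        · rw [hj']; exact hBj0
        · exact hBnn j' (by omega) h2
      · by_cases hj' : j' = j
        · subst hj'; exact htar
        · exact hT j' (by omega) h2
      · -- one level down: lo_j·U_{j−1} = (lo_jν_j)C_jB(j+1) + lo_jU_j ≤ (Ax_jC_j + κ_j)B(j+1); times hi_{j−1}, the closure, and B j ≥ (1 − x_jC_j)B(j+1)
        have hUsplit : U (j - 1) = ν j m * (C j * B (j + 1)) + U j := by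
          rw [hU (j - 1), hU j, Nat.sub_add_cancel hj1, sum_eq_sum_Ico_succ_bot hjr]
        have hlh : (lo j : ℝ) ≤ hi j := by exact_mod_cast hlohi j hj1 hjr
        have hlo0 : (0 : ℝ) < lo j := by exact_mod_cast hlo1 j hj1 hjr
        have hC0 : (0 : ℝ) ≤ C j := by linarith [hC1 j]
        have hUj0 : 0 ≤ U j := by
          rw [hU j]
          exact sum_nonneg fun i hi' => mul_nonneg (hν0 i m)
            (mul_nonneg (by linarith [hC1 i]) (hBnn (i + 1) (by have := (mem_Ico.mp hi').1; omega) (by have := (mem_Ico.mp hi').2; omega)))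
        have hU0 : 0 ≤ U (j - 1) := by
          rw [hUsplit]; exact add_nonneg (mul_nonneg (hν0 j m) (mul_nonneg hC0 hBj1)) hUj0
        have h1 : (lo j : ℝ) * U (j - 1) ≤ (A * x j m * C j + κ j m) * B (j + 1) := by
          have hνx' := hνx j m hj1 hjr
          have hCB : 0 ≤ C j * B (j + 1) := mul_nonneg hC0 hBj1
          calc (lo j : ℝ) * U (j - 1) = ((lo j : ℝ) * ν j m) * (C j * B (j + 1)) + (lo j : ℝ) * U j := by rw [hUsplit]; ring
            _ ≤ A * x j m * (C j * B (j + 1)) + (hi j : ℝ) * U j :=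
                add_le_add (mul_le_mul_of_nonneg_right hνx' hCB) (mul_le_mul_of_nonneg_right hlh hUj0)
            _ ≤ A * x j m * (C j * B (j + 1)) + κ j m * B (j + 1) := by linarith
            _ = (A * x j m * C j + κ j m) * B (j + 1) := by ring
        have h2 : (hi (j - 1) : ℝ) * U (j - 1) * lo j ≤ κ (j - 1) m * B j * lo j := by
          calc (hi (j - 1) : ℝ) * U (j - 1) * lo j = (hi (j - 1) : ℝ) * ((lo j : ℝ) * U (j - 1)) := by ring
            _ ≤ (hi (j - 1) : ℝ) * ((A * x j m * C j + κ j m) * B (j + 1)) := mul_le_mul_of_nonneg_left h1 (Nat.cast_nonneg _)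
            _ = (hi (j - 1) : ℝ) * (A * x j m * C j + κ j m) * B (j + 1) := by ring
            _ ≤ κ (j - 1) m * (1 - x j m * C j) * lo j * B (j + 1) := mul_le_mul_of_nonneg_right hcl hBj1
            _ = κ (j - 1) m * lo j * ((1 - x j m * C j) * B (j + 1)) := by ring
            _ ≤ κ (j - 1) m * lo j * B j := mul_le_mul_of_nonneg_left hBj (mul_nonneg (hκ0 _ m) hlo0.le)
            _ = κ (j - 1) m * B j * lo j := by ring
        exact le_of_mul_le_mul_right h2 hlo0
  -- THE LAST LEVEL: the youngest cluster needs only x₀ C₀ ≤ 1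
  obtain ⟨hBnn, hT, hU0⟩ := main (r - 1) 1 (by omega) le_rfl
  rw [Nat.sub_self] at hU0
  obtain ⟨-, hpeel⟩ := level 0 hrpos (fun j' h1 h2 => hBnn j' (by omega) h2) (fun j' h1 h2 => hT j' (by omega) h2) hU0
  have hB1 : 0 ≤ B 1 := hBnn 1 le_rfl (by omega)
  have h1 : 0 ≤ 1 - x 0 m * C 0 := by rw [hC 0]; linarith [hclose0 m]
  rw [← hB0]
  exact le_trans (mul_nonneg h1 hB1) hpeel


end Summit.QuantumFields.BalabanUV.Beta.EriceRemainderEnclosureHistoryAutonomyComparisonAgeCompositionAdaptiveCascadeRate
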